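import Summits.QuantumFields.YangMills.Theorems.ColdBoxAllGroupsBoxFloorAllGroupsCubicG
import Summits.QuantumFields.YangMills.Theorems.TwistExponentGapTwistedFlatRigidity
import HarnessLib

/-!
# The twisted plaquette cost near a twisted-flat configuration = ½‖linearised curvature‖² up to a cubic remainder
# (route-independent helper toward the crux `TwistExponentGap.RigidTwistCeiling` ⟨stmt-QuantumFields-24054⟩, step (W3); free hands
# of width seat ym-line-sfw-p2-w3)

For a configuration `V` written in the exponential chart at a `z`-twisted-flat `U₀`, `r(V e) = e^{X_e} r(U₀ e)` with `X_e ∈ 𝔤_r`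
(`repLieAlgebra r`, skew-Hermitian), `‖X_e‖_F ≤ m ≤ 1/4`, the twisted plaquette holonomy is a product of four exponentials
`r(z_p V_p) = e^{Y₁}e^{Y₂}e^{Y₃}e^{Y₄}` with `Y₁ = X_{x,μ}`, `Y₂ = Ad_{U₀(x,μ)}X_{x+e_μ,ν}`, `Y₃ = −Ad_{U₀(x,ν)}X_{x+e_ν,μ}`, `Y₄ = −X_{x,ν}`
(`Ad_u Y = r(u)Yr(u⁻¹)`; the twist disappears because `z_p U₀,p = 1` and `r(z)` is central), so the tree's cubic remainder
`ColdBoxAllGroups.abs_cost_exp_prod_sub_half_norm_sq_le` gives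
`|(N − Re tr r(z_pV_p)) − ½‖(d¹X)_p‖²| ≤ 190 m³`, `(d¹X)_p = Y₁+Y₂+Y₃+Y₄` the `Ad∘r∘U₀`-twisted linearised curvature
(`abs_twistedCost_sub_half_norm_sq_le`).
HONEST FRAMING: matrix bookkeeping; nothing here bears on a summit statement or on the Yang–Mills mass gap.
-/

set_option autoImplicit false

noncomputable section

open scoped Matrix Matrix.Norms.Frobenius
open NormedSpace
open Literature.MathematicalPhysics.QuantumFieldTheory
open Literature.MathematicalPhysics.QuantumLattice

namespace Summit.QuantumFields.YangMills.Theorems.TwistExponentGap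

variable {G : Type*} [Group G] [TopologicalSpace G] [CompactSpace G]

omit [CompactSpace G] in
/-- `e^{X} e^{−X} = 1` (matrix exponential). -/
theorem exp_mul_exp_neg {N : ℕ} (X : Matrix (Fin N) (Fin N) ℂ) : exp X * exp (-X) = 1 := by
  have h := Matrix.exp_add_of_commute X (-X) (Commute.neg_right (Commute.refl X))
  rw [add_neg_cancel, exp_zero] at h
  exact h.symm

omit [CompactSpace G] in
/-- Inverting a link in the chart: `r(v) = e^{X} r(u)` gives `r(v⁻¹) = r(u⁻¹) e^{−X}`. -/
theorem rho_inv_of_eq_exp_mul (r : LatticeRep G) {v u : G} {X : Matrix (Fin r.N) (Fin r.N) ℂ}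
    (h : r.ρ v = exp X * r.ρ u) : r.ρ v⁻¹ = r.ρ u⁻¹ * exp (-X) := by
  have h1 : r.ρ v⁻¹ * r.ρ v = 1 := by rw [← map_mul, inv_mul_cancel, map_one]
  have h2 : r.ρ v * (r.ρ u⁻¹ * exp (-X)) = 1 := by
    rw [h, mul_assoc, ← mul_assoc (r.ρ u), ← map_mul, mul_inv_cancel, map_one, one_mul, exp_mul_exp_neg]
  calc r.ρ v⁻¹ = r.ρ v⁻¹ * (r.ρ v * (r.ρ u⁻¹ * exp (-X))) := by rw [h2, mul_one]
    _ = r.ρ u⁻¹ * exp (-X) := by rw [← mul_assoc, h1, one_mul]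

omit [CompactSpace G] in
/-- `Ad` through the exponential: `r(u) e^{Y} r(u⁻¹) = e^{r(u) Y r(u⁻¹)}`. -/
theorem rho_mul_exp_mul_rho_inv (r : LatticeRep G) (u : G) (Y : Matrix (Fin r.N) (Fin r.N) ℂ) :
    r.ρ u * exp Y * r.ρ u⁻¹ = exp (r.ρ u * Y * r.ρ u⁻¹) := by
  have hs : SemiconjBy (r.ρ u) Y (r.ρ u * Y * r.ρ u⁻¹) := by
    show r.ρ u * Y = r.ρ u * Y * r.ρ u⁻¹ * r.ρ u
    rw [mul_assoc (r.ρ u * Y), ← map_mul, inv_mul_cancel, map_one, mul_one]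
  -- `r u * e^Y = e^{Ad Y} * r u`
  have h : r.ρ u * exp Y = exp (r.ρ u * Y * r.ρ u⁻¹) * r.ρ u := hs.exp_right.eq
  calc r.ρ u * exp Y * r.ρ u⁻¹ = exp (r.ρ u * Y * r.ρ u⁻¹) * r.ρ u * r.ρ u⁻¹ := by rw [h]
    _ = exp (r.ρ u * Y * r.ρ u⁻¹) := by rw [mul_assoc, ← map_mul, mul_inv_cancel, map_one, mul_one]

omit [CompactSpace G] in
/-- `Ad` of a unitary representation preserves skew-Hermitian matrices. -/
theorem conjTranspose_conj_eq_neg (r : LatticeRep G) (u : G) {Y : Matrix (Fin r.N) (Fin r.N) ℂ} (hY : Yᴴ = -Y) :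
    (r.ρ u * Y * r.ρ u⁻¹)ᴴ = -(r.ρ u * Y * r.ρ u⁻¹) := by
  have hstar : ∀ g : G, (r.ρ g)ᴴ = r.ρ g⁻¹ := fun g => by
    have h1 : r.ρ g⁻¹ * r.ρ g = 1 := by rw [← map_mul, inv_mul_cancel, map_one]
    have h2 : r.ρ g * star (r.ρ g) = 1 := Matrix.mem_unitaryGroup_iff.1 (r.mem_unitary g)
    rw [← Matrix.star_eq_conjTranspose]
    calc star (r.ρ g) = (r.ρ g)⁻¹ := (Matrix.inv_eq_right_inv h2).symm
      _ = r.ρ g⁻¹ := Matrix.inv_eq_left_inv h1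
  rw [Matrix.conjTranspose_mul, Matrix.conjTranspose_mul, hstar, hstar, inv_inv, hY]
  noncomm_ring

omit [CompactSpace G] in
/-- The Frobenius norm is `Ad`-invariant. -/
theorem norm_conj_eq (r : LatticeRep G) (u : G) (Y : Matrix (Fin r.N) (Fin r.N) ℂ) : ‖r.ρ u * Y * r.ρ u⁻¹‖ = ‖Y‖ := by
  rw [Matrix.frobenius_norm_mul_unitaryGroup (r.ρ u * Y) ⟨r.ρ u⁻¹, r.mem_unitary _⟩,
    Matrix.frobenius_norm_unitaryGroup_mul ⟨r.ρ u, r.mem_unitary _⟩]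

/-- **The twisted plaquette as four exponentials.**  At a plaquette `(x; μ, ν)` with central twist `t` and `t·U₀,□ = 1`,
if `r(V e) = e^{X_e} r(U₀ e)` on its four links with `X_e ∈ 𝔤_r`, then
`r(t · V_□) = e^{X₁} · e^{Ad_{U₀(x,μ)} X₂} · e^{−Ad_{U₀(x,ν)} X₃} · e^{−X₄}`
(`X₁ = X(x,μ)`, `X₂ = X(x+e_μ,ν)`, `X₃ = X(x+e_ν,μ)`, `X₄ = X(x,ν)`). -/
theorem rho_twistedPlaquette_eq_exp_prod (r : LatticeRep G) {d S : ℕ} (U₀ V : GaugeConfig d S G)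
    (x : Site d S) (μ ν : Fin d) {t : G} (ht : t ∈ Subgroup.center G)
    (hflat : t * plaquetteHolonomy U₀ x μ ν = 1)
    (X : Edge d S → Matrix (Fin r.N) (Fin r.N) ℂ) (hX𝔤 : ∀ e, X e ∈ repLieAlgebra r)
    (hV : ∀ e, r.ρ (V e) = exp (X e) * r.ρ (U₀ e)) :
    r.ρ (t * plaquetteHolonomy V x μ ν) =
      exp (X (x, μ)) * exp (r.ρ (U₀ (x, μ)) * X (x.shift μ, ν) * r.ρ (U₀ (x, μ))⁻¹) *
        exp (-(r.ρ (U₀ (x, ν)) * X (x.shift ν, μ) * r.ρ (U₀ (x, ν))⁻¹)) * exp (-X (x, ν)) := by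
  -- names
  set A₁ := r.ρ (U₀ (x, μ)) with hA₁
  set A₂ := r.ρ (U₀ (x.shift μ, ν)) with hA₂
  set A₄ := r.ρ (U₀ (x, ν)) with hA₄
  -- the group identity `t U₂ U₃⁻¹ = U₁⁻¹ U₄`
  have hgrp : t * U₀ (x.shift μ, ν) * (U₀ (x.shift ν, μ))⁻¹ = (U₀ (x, μ))⁻¹ * U₀ (x, ν) := by
    have htc : ∀ g : G, g * t = t * g := fun g => Subgroup.mem_center_iff.1 ht g
    simp only [plaquetteHolonomy] at hflat
    -- from `t U₁ U₂ U₃⁻¹ U₄⁻¹ = 1`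
    have h1 : t * U₀ (x.shift μ, ν) * (U₀ (x.shift ν, μ))⁻¹ =
        (U₀ (x, μ))⁻¹ * (t * (U₀ (x, μ) * U₀ (x.shift μ, ν) * (U₀ (x.shift ν, μ))⁻¹ * (U₀ (x, ν))⁻¹)) * U₀ (x, ν) := by
      rw [← mul_assoc t, ← mul_assoc t, ← mul_assoc t, ← htc (U₀ (x, μ))]; group
    rw [h1, hflat, mul_one]
  -- inverted links
  have hV3 : r.ρ (V (x.shift ν, μ))⁻¹ = r.ρ (U₀ (x.shift ν, μ))⁻¹ * exp (-X (x.shift ν, μ)) :=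
    rho_inv_of_eq_exp_mul r (hV (x.shift ν, μ))
  have hV4 : r.ρ (V (x, ν))⁻¹ = r.ρ (U₀ (x, ν))⁻¹ * exp (-X (x, ν)) := rho_inv_of_eq_exp_mul r (hV (x, ν))
  -- `r t` commutes with `e^{X₁}` and with `A₁ e^{X₂}`
  have htX1 : r.ρ t * exp (X (x, μ)) = exp (X (x, μ)) * r.ρ t := by
    have hs : SemiconjBy (r.ρ t) (X (x, μ)) (X (x, μ)) := rho_center_mul_eq_mul r ht (hX𝔤 (x, μ))
    exact hs.exp_right.eq
  have htA : ∀ g : G, r.ρ t * r.ρ g = r.ρ g * r.ρ t := fun g => by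
    rw [← map_mul, ← map_mul, (Subgroup.mem_center_iff.1 ht g).symm]
  have htX2 : r.ρ t * exp (X (x.shift μ, ν)) = exp (X (x.shift μ, ν)) * r.ρ t := by
    have hs : SemiconjBy (r.ρ t) (X (x.shift μ, ν)) (X (x.shift μ, ν)) := rho_center_mul_eq_mul r ht (hX𝔤 _)
    exact hs.exp_right.eq
  -- the exponentials of the transported coordinates
  have hY2 : exp (A₁ * X (x.shift μ, ν) * r.ρ (U₀ (x, μ))⁻¹) = A₁ * exp (X (x.shift μ, ν)) * r.ρ (U₀ (x, μ))⁻¹ := by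
    rw [hA₁, rho_mul_exp_mul_rho_inv]
  have hY3 : exp (-(A₄ * X (x.shift ν, μ) * r.ρ (U₀ (x, ν))⁻¹)) = A₄ * exp (-X (x.shift ν, μ)) * r.ρ (U₀ (x, ν))⁻¹ := by
    rw [hA₄, show -(r.ρ (U₀ (x, ν)) * X (x.shift ν, μ) * r.ρ (U₀ (x, ν))⁻¹) =
      r.ρ (U₀ (x, ν)) * (-X (x.shift ν, μ)) * r.ρ (U₀ (x, ν))⁻¹ by noncomm_ring, rho_mul_exp_mul_rho_inv]
  -- compute
  have e2 : r.ρ t * r.ρ (U₀ (x.shift μ, ν)) * r.ρ (U₀ (x.shift ν, μ))⁻¹ = r.ρ (U₀ (x, μ))⁻¹ * r.ρ (U₀ (x, ν)) := by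
    rw [← map_mul, ← map_mul, hgrp, map_mul]
  -- `r t` moves past `e^{X₁} r(U₁) e^{X₂}`
  have hmove : r.ρ t * (exp (X (x, μ)) * r.ρ (U₀ (x, μ)) * exp (X (x.shift μ, ν))) =
      exp (X (x, μ)) * r.ρ (U₀ (x, μ)) * exp (X (x.shift μ, ν)) * r.ρ t := by
    calc r.ρ t * (exp (X (x, μ)) * r.ρ (U₀ (x, μ)) * exp (X (x.shift μ, ν)))
        = (r.ρ t * exp (X (x, μ))) * r.ρ (U₀ (x, μ)) * exp (X (x.shift μ, ν)) := by noncomm_ring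
      _ = (exp (X (x, μ)) * r.ρ t) * r.ρ (U₀ (x, μ)) * exp (X (x.shift μ, ν)) := by rw [htX1]
      _ = exp (X (x, μ)) * (r.ρ t * r.ρ (U₀ (x, μ))) * exp (X (x.shift μ, ν)) := by noncomm_ring
      _ = exp (X (x, μ)) * (r.ρ (U₀ (x, μ)) * r.ρ t) * exp (X (x.shift μ, ν)) := by rw [htA]
      _ = exp (X (x, μ)) * r.ρ (U₀ (x, μ)) * (r.ρ t * exp (X (x.shift μ, ν))) := by noncomm_ring
      _ = exp (X (x, μ)) * r.ρ (U₀ (x, μ)) * (exp (X (x.shift μ, ν)) * r.ρ t) := by rw [htX2]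
      _ = exp (X (x, μ)) * r.ρ (U₀ (x, μ)) * exp (X (x.shift μ, ν)) * r.ρ t := by noncomm_ring
  calc r.ρ (t * plaquetteHolonomy V x μ ν)
      = r.ρ t * (exp (X (x, μ)) * r.ρ (U₀ (x, μ)) * exp (X (x.shift μ, ν))) *
          (r.ρ (U₀ (x.shift μ, ν)) * r.ρ (U₀ (x.shift ν, μ))⁻¹) * exp (-X (x.shift ν, μ)) *
          (r.ρ (U₀ (x, ν))⁻¹ * exp (-X (x, ν))) := by
        rw [map_mul, plaquetteHolonomy, map_mul, map_mul, map_mul, hV (x, μ), hV (x.shift μ, ν), hV3, hV4]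
        noncomm_ring
    _ = exp (X (x, μ)) * r.ρ (U₀ (x, μ)) * exp (X (x.shift μ, ν)) *
          (r.ρ t * r.ρ (U₀ (x.shift μ, ν)) * r.ρ (U₀ (x.shift ν, μ))⁻¹) * exp (-X (x.shift ν, μ)) *
          (r.ρ (U₀ (x, ν))⁻¹ * exp (-X (x, ν))) := by
        rw [hmove]; noncomm_ring
    _ = exp (X (x, μ)) * r.ρ (U₀ (x, μ)) * exp (X (x.shift μ, ν)) *
          (r.ρ (U₀ (x, μ))⁻¹ * r.ρ (U₀ (x, ν))) * exp (-X (x.shift ν, μ)) *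
          (r.ρ (U₀ (x, ν))⁻¹ * exp (-X (x, ν))) := by rw [e2]
    _ = exp (X (x, μ)) * (A₁ * exp (X (x.shift μ, ν)) * r.ρ (U₀ (x, μ))⁻¹) *
          (A₄ * exp (-X (x.shift ν, μ)) * r.ρ (U₀ (x, ν))⁻¹) * exp (-X (x, ν)) := by
        rw [hA₁, hA₄]; noncomm_ring
    _ = _ := by rw [hY2, hY3]

/-- **Twisted plaquette cost vs. linearised curvature (cubic remainder).**  In the situation of
`rho_twistedPlaquette_eq_exp_prod`, if moreover `‖X_e‖_F ≤ m ≤ 1/4` on the four links, then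
`|(N − Re tr r(t·V_□)) − ½‖D‖²| ≤ 190 m³` with
`D = X(x,μ) + Ad_{U₀(x,μ)}X(x+e_μ,ν) − Ad_{U₀(x,ν)}X(x+e_ν,μ) − X(x,ν)`. -/
theorem abs_twistedCost_sub_half_norm_sq_le (r : LatticeRep G) {d S : ℕ} (U₀ V : GaugeConfig d S G)
    (x : Site d S) (μ ν : Fin d) {t : G} (ht : t ∈ Subgroup.center G)
    (hflat : t * plaquetteHolonomy U₀ x μ ν = 1)
    (X : Edge d S → Matrix (Fin r.N) (Fin r.N) ℂ) (hX𝔤 : ∀ e, X e ∈ repLieAlgebra r)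
    (hV : ∀ e, r.ρ (V e) = exp (X e) * r.ρ (U₀ e)) {m : ℝ} (hm : m ≤ 1 / 4) (hXm : ∀ e, ‖X e‖ ≤ m) :
    |((r.N : ℝ) - (r.ρ (t * plaquetteHolonomy V x μ ν)).trace.re) -
        ‖X (x, μ) + r.ρ (U₀ (x, μ)) * X (x.shift μ, ν) * r.ρ (U₀ (x, μ))⁻¹ -
          r.ρ (U₀ (x, ν)) * X (x.shift ν, μ) * r.ρ (U₀ (x, ν))⁻¹ - X (x, ν)‖ ^ 2 / 2| ≤ 190 * m ^ 3 := by
  rw [rho_twistedPlaquette_eq_exp_prod r U₀ V x μ ν ht hflat X hX𝔤 hV]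
  have hskew : ∀ e, (X e)ᴴ = -X e := fun e => by
    have h := repLieAlgebra_le_skewAdjoint r (hX𝔤 e)
    have h' : star (X e) = -X e := skewAdjoint.mem_iff.mp h
    rwa [Matrix.star_eq_conjTranspose] at h'
  have h := ColdBoxAllGroups.abs_cost_exp_prod_sub_half_norm_sq_le
    (A₁ := X (x, μ)) (A₂ := r.ρ (U₀ (x, μ)) * X (x.shift μ, ν) * r.ρ (U₀ (x, μ))⁻¹)
    (A₃ := -(r.ρ (U₀ (x, ν)) * X (x.shift ν, μ) * r.ρ (U₀ (x, ν))⁻¹)) (A₄ := -X (x, ν))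
    (hskew _) (conjTranspose_conj_eq_neg r _ (hskew _))
    (by rw [Matrix.conjTranspose_neg, conjTranspose_conj_eq_neg r _ (hskew _), neg_neg])
    (by rw [Matrix.conjTranspose_neg, hskew, neg_neg]) hm (hXm _)
    (by rw [norm_conj_eq]; exact hXm _) (by rw [norm_neg, norm_conj_eq]; exact hXm _) (by rw [norm_neg]; exact hXm _)
  have e : X (x, μ) + r.ρ (U₀ (x, μ)) * X (x.shift μ, ν) * r.ρ (U₀ (x, μ))⁻¹ +
      -(r.ρ (U₀ (x, ν)) * X (x.shift ν, μ) * r.ρ (U₀ (x, ν))⁻¹) + -X (x, ν) =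
      X (x, μ) + r.ρ (U₀ (x, μ)) * X (x.shift μ, ν) * r.ρ (U₀ (x, μ))⁻¹ -
        r.ρ (U₀ (x, ν)) * X (x.shift ν, μ) * r.ρ (U₀ (x, ν))⁻¹ - X (x, ν) := by abel
  rwa [e] at h

end Summit.QuantumFields.YangMills.Theorems.TwistExponentGap

end
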